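import Summits.ResolutionOfSingularities.ResolutionOfSingularities.Theorems.RadicialJungCleanModelsCcurveQuotientDVR
import Summits.ResolutionOfSingularities.ResolutionOfSingularities.Theorems.RadicialJungCleanModelsCcurveUnitCaseFrac
import HarnessLib

/-!
# Route `RadicialJung`, crux `CleanModels` (stmt-15917) — (C-curve) sub-line, brick for `stub_Cc_persistForm2`: the algebraic step at the local ring of the closed point

Lead `res-B-lead-1` g6 (plan `Cruxes/CleanModels/Lines/Sketch-memo-Ccurve-plan.md` §1 S5a).  OURS · counted 0.  Nothing here proves resolution in characteristic `p`; resolution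
in char `p` is NOT proved.

`S` a regular local ring of characteristic `p` with regular system of parameters `(t₀, t₁, t₂)` (the local ring of the model at the centre `P` of `O`, the centre curve `C` of
`v₁` being `V(t₀, t₁)`), such that every element of `S` is a `p`-th power modulo `𝔪_S` (perfect residue field) and the fraction field of the discrete valuation ring
`D = S ⧸ (t₀, t₁) = O_{C,P}` has `p`-degree `p` (perfect ground field, `C` a curve).  If `w ∈ S` is NOT a `p`-th power modulo `(t₀, t₁)` even after clearing
denominators off the curve (`b ∉ (t₀, t₁) ⇒ b^p w − a^p ∉ (t₀, t₁)` — form (2) at `S_{(t₀,t₁)}`), then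
`w − c^p = U · t₂^i + t₀ α + t₁ β` with `U` a unit of `S` and `p ∤ i` (`exists_sub_pow_eq_of_form2`): ✓ `quotient_span_pair_dvr` + ✓ `exists_sub_pow_eq_unit_mul_pow`
(ring level, in `D`), lifted to `S`.  The `p`-degree enters in REPRESENTATION FORM (`hrep`: every `x ∈ S` has `d^p x ≡ Σ_{j<p} w_j^p t₂^j (mod (t₀,t₁))`, `d ∉ (t₀,t₁)`),
which the assembly derives from ✓ `finrank_frobenius_residueField_eq_pow` / ✓ `Ccurve.exists_sum_pow_mul_pow` at `κ(C)` (instance-free interface).  The point blow-ups of `stub_Cc_pointPrep` then turn the right-hand side into `z^i ·` unit = form (1).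
Helpers: `charP_quotient_of_ne_top` (a proper quotient of a ring of prime characteristic `p` has characteristic `p`).
-/

noncomputable section

set_option linter.dupNamespace false

open IsLocalRing Literature.AlgebraicGeometry.Resolution

namespace Summit.ResolutionOfSingularities.ResolutionOfSingularities.Theorems.RadicialJung.CleanModels.Ccurve

/-- A proper quotient of a ring of prime characteristic `p` has characteristic `p`. [folklore] -/
theorem charP_quotient_of_ne_top {S : Type} [CommRing S] (p : ℕ) [hp : Fact p.Prime] [CharP S p] (I : Ideal S) (hI : I ≠ ⊤) :
    CharP (S ⧸ I) p := by
  refine CharP.quotient' p I fun x hx => ?_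
  by_contra hx0
  apply hI
  -- `(x : S) ≠ 0` with `p` prime: `x` is a unit of the prime field inside `S`
  have hnd : ¬ p ∣ x := fun hdvd => hx0 ((CharP.cast_eq_zero_iff S p x).mpr hdvd)
  have hcop : Nat.Coprime x p := (Nat.coprime_comm.mp ((Nat.Prime.coprime_iff_not_dvd hp.out).mpr hnd))
  obtain ⟨u, hu⟩ : IsUnit ((x : ZMod p) ) := by
    rw [ZMod.isUnit_iff_coprime]; exact hcop
  have hxu : IsUnit (x : S) := by
    have := (ZMod.castHom (dvd_refl p) S).isUnit_map ⟨u, hu⟩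
    rwa [map_natCast] at this
  exact Ideal.eq_top_of_isUnit_mem I hx hxu

/-- **The algebraic step of `stub_Cc_persistForm2`.**  `S` regular local of characteristic `p` with r.s.p. `(t₀, t₁, t₂)`, perfect residues (`hperf`), and the
«`p`-degree `p` of `κ(C)`» in representation form (`hrep`: every `x ∈ S` satisfies `d^p x ≡ Σ_{j<p} w_j^p t₂^j (mod (t₀, t₁))` for some `d ∉ (t₀, t₁)`); if `w` is not a
`p`-th power modulo `(t₀, t₁)` after clearing such denominators (`hw`, i.e. form (2) at `S_{(t₀,t₁)}`), then `w − c^p = U t₂^i + t₀ α + t₁ β` with `U` a unit and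
`p ∤ i`. [folklore] -/
theorem exists_sub_pow_eq_of_form2 {S : Type} [CommRing S] [IsRegularLocalRing S] (p : ℕ) [hp : Fact p.Prime] [CharP S p]
    (hd : (maximalIdeal S).spanFinrank = 3) (x y z : S) (hxyz : Ideal.span ({x, y, z} : Set S) = maximalIdeal S)
    (hperf : ∀ u : S, ∃ e : S, u - e ^ p ∈ maximalIdeal S)
    (hrep : ∀ w : S, ∃ (d : S) (ws : Fin p → S), d ∉ Ideal.span ({x, y} : Set S) ∧
      d ^ p * w - ∑ j : Fin p, ws j ^ p * z ^ (j : ℕ) ∈ Ideal.span ({x, y} : Set S))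
    (w : S) (hw : ∀ a b : S, b ∉ Ideal.span ({x, y} : Set S) → b ^ p * w - a ^ p ∉ Ideal.span ({x, y} : Set S)) :
    ∃ (c U α β : S) (i : ℕ), IsUnit U ∧ ¬ p ∣ i ∧ w - c ^ p = U * z ^ i + x * α + y * β := by
  classical
  set P : Ideal S := Ideal.span ({x, y} : Set S) with hP
  let t : Fin 3 → S := ![x, y, z]
  have ht : Ideal.span (Set.range t) = maximalIdeal S := by
    rw [← hxyz]; congr 1; ext a; simp only [t, Set.mem_range, Set.mem_insert_iff, Set.mem_singleton_iff]
    constructor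
    · rintro ⟨i, rfl⟩; fin_cases i <;> simp
    · rintro (rfl | rfl | rfl)
      exacts [⟨0, rfl⟩, ⟨1, rfl⟩, ⟨2, rfl⟩]
  obtain ⟨hdom, hdvr, hz⟩ := quotient_span_pair_dvr hd t ht
  change IsDomain (S ⧸ P) at hdom
  change IsDiscreteValuationRing (S ⧸ P) at hdvr
  change Irreducible (Ideal.Quotient.mk P z) at hz
  haveI := hdom
  haveI := hdvr
  have hPtop : P ≠ ⊤ := Ideal.IsPrime.ne_top ((Ideal.Quotient.isDomain_iff_prime P).mp hdom)
  haveI hcharD : CharP (S ⧸ P) p := charP_quotient_of_ne_top p P hPtop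
  have hperfD : ∀ u : S ⧸ P, ∃ e : S ⧸ P, u - e ^ p ∈ maximalIdeal (S ⧸ P) := quotient_residue_pth_powers p P hperf
  -- the representation of `w̄` in `D = S ⧸ P`
  obtain ⟨d, ws, hdP, hrepw⟩ := hrep w
  have hrepD : Ideal.Quotient.mk P d ^ p * Ideal.Quotient.mk P w =
      ∑ j : Fin p, Ideal.Quotient.mk P (ws j) ^ p * Ideal.Quotient.mk P z ^ (j : ℕ) := by
    have h := (Ideal.Quotient.eq (I := P)).mpr hrepw
    simpa [map_sum, map_mul, map_pow] using h
  -- some coefficient with `j ≠ 0` survives, by `hw`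
  have hj : ∃ j₀ : Fin p, (j₀ : ℕ) ≠ 0 ∧ Ideal.Quotient.mk P (ws j₀) ≠ 0 := by
    by_contra hall
    push Not at hall
    apply hw (ws ⟨0, hp.out.pos⟩) d hdP
    have h0 : (⟨0, hp.out.pos⟩ : Fin p) ∈ (Finset.univ : Finset (Fin p)) := Finset.mem_univ _
    have hsum : ∑ j : Fin p, ws j ^ p * z ^ (j : ℕ) - ws ⟨0, hp.out.pos⟩ ^ p ∈ P := by
      rw [← Finset.add_sum_erase _ _ h0]
      simp only [pow_zero, mul_one, add_sub_cancel_left]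
      refine P.sum_mem fun j hj => ?_
      have hj0 : (j : ℕ) ≠ 0 := fun h => (Finset.ne_of_mem_erase hj) (Fin.ext h)
      have hz0 : ws j ∈ P := by rw [← Ideal.Quotient.eq_zero_iff_mem]; exact hall j hj0
      exact P.mul_mem_right _ (P.pow_mem_of_mem hz0 p hp.out.pos)
    have : d ^ p * w - ws ⟨0, hp.out.pos⟩ ^ p =
        (d ^ p * w - ∑ j : Fin p, ws j ^ p * z ^ (j : ℕ)) + (∑ j : Fin p, ws j ^ p * z ^ (j : ℕ) - ws ⟨0, hp.out.pos⟩ ^ p) := by ring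
    rw [this]; exact P.add_mem hrepw hsum
  obtain ⟨j₀, hj₀, hw₀⟩ := hj
  -- the unit case in `D`
  obtain ⟨cbar, i, ubar, hi, hc⟩ := exists_sub_pow_eq_unit_mul_pow p hz hperfD (Ideal.Quotient.mk P w) (Ideal.Quotient.mk P d)
    (fun j => Ideal.Quotient.mk P (ws j)) hrepD j₀ hj₀ hw₀
  -- lift to `S`
  obtain ⟨c, rfl⟩ := Ideal.Quotient.mk_surjective cbar
  obtain ⟨U, hU⟩ := Ideal.Quotient.mk_surjective (ubar : S ⧸ P)
  haveI : IsLocalHom (Ideal.Quotient.mk P) := IsLocalHom.of_surjective _ Ideal.Quotient.mk_surjective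
  have hUunit : IsUnit U := isUnit_of_map_unit (Ideal.Quotient.mk P) U (by rw [hU]; exact ubar.isUnit)
  have hmem : w - c ^ p - U * z ^ i ∈ P := by
    rw [← Ideal.Quotient.eq, map_sub, map_pow, hc, map_mul, map_pow, hU]
  obtain ⟨α, β, hαβ⟩ := Ideal.mem_span_pair.mp hmem
  refine ⟨c, U, α, β, i, hUunit, hi, ?_⟩
  have h1 : w - c ^ p = U * z ^ i + (w - c ^ p - U * z ^ i) := by ring
  rw [h1, ← hαβ]; ring

end Summit.ResolutionOfSingularities.ResolutionOfSingularities.Theorems.RadicialJung.CleanModels.Ccurve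

end
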